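import Summits.CriticalPhenomena.CardyFormulaZ2.Theorems.CardyBoundaryCoulombGasHalfPlaneMarkDensityLawBoxExhaustionPart4
import Summits.CriticalPhenomena.CardyFormulaZ2.Theorems.CardyBoundaryCoulombGasHalfPlaneMarkDensityLawBoxExhaustionPart5
import Summits.CriticalPhenomena.CardyFormulaZ2.Theorems.CardyBoundaryCoulombGasHalfPlaneMarkDensityLawBoxExhaustionPart6

/-!
# Box exhaustion: `RectilinearCardy → stub_collinearCardy` (line `Sketch`, crux `HalfPlaneMarkDensityLaw`)

Crux `Summit.CriticalPhenomena.CardyFormulaZ2.Theses.CardyBoundaryCoulombGas.HalfPlaneMarkDensityLaw`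
(stmt-CriticalPhenomena-5661), line `Sketch`, stub `stub_collinearCardy` (C⁺: collinear half-plane
Cardy for bond-`ℤ²`, open-problem strength). This file proves the TRANSFER
`collinearCardy_of_rectilinearCardy`: the sibling crux `RectilinearCardy` (stmt-CriticalPhenomena-5660,
Cardy's formula for bond-`ℤ²` in every rectilinear conformal rectangle) implies C⁺,

  `∀ a < b < c < y`, `P_{1/2}[[⌊an⌋,⌊bn⌋]×{0} ↔ [⌊cn⌋,⌊yn⌋]×{0} in ℤ×ℕ] → F(η(a,b,c,y))`.

Proof (RSW box exhaustion, parts 1–6). Fix the Schwarz–Christoffel box `Ω = (-K,K)×(0,H)`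
(`k = 1/2`; part 4) and a scale `t = κ/L`. The box with the four collinear bottom marks `t·(a,b,c,y)`
is an axis-parallel conformal rectangle `R_t` whose Cardy modulus is `crossRatio u_t`, `u_t` the
`F(k²;·)`-preimages of the marks (explicit uniformizing datum `(F_k, u_t)`, part 4); by
`RectilinearCardy`, `bondDomainCrossingProb R_t (t/n) → F(crossRatio u_t)` (part 6). At mesh `t/n` the
discrete arcs of `R_t` are the lattice rows `{an ≤ m ≤ bn}×{1}`, `{cn ≤ m ≤ yn}×{1}` (parts 1–2), so a
crossing of `Ω_{t/n}` is a half-plane crossing shifted by `e₁` (LOWER bound, translation invariance),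
and a half-plane crossing either stays in the lattice box — then it is a crossing of `Ω_{t/n}` for the
ENLARGED marks `t·(a-ε',b,c-ε',y)`, the slack `ε'n ≥ 1` absorbing the floors — or joins `Λ_{Mn}` to
`Λ_{MnL}ᶜ`, probability `≤ C L^{-α}` by the tree's RSW annulus bound (UPPER bound, part 3). Finally
`crossRatio u_t → crossRatio (a,b,c,y)` as `t → 0⁺` (`u_t/t → (a,b,c,y)` since `F(k²;·)'(0) = 1`, and
the cross-ratio is scale invariant; part 5), `F` is continuous on `(0,1)` and the cross-ratio is
continuous in `ε'`: letting `n → ∞`, then `L → ∞`, then `ε' → 0` gives C⁺ (sandwich criterion, part 5).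
-/

noncomputable section

namespace Summit.CriticalPhenomena.CardyFormulaZ2.Cruxes.HalfPlaneMarkDensityLaw.SketchLine

open Set Metric MeasureTheory Filter
open Literature.Probability.LatticeModels
open Literature.Probability.Percolation hiding cardyFunction
open Literature.Probability.RandomPlanarGeometry
open UpperHalfPlane (upperHalfPlaneSet)
open Summit.CriticalPhenomena.CardyFormulaZ2.Theorems.HalfPlaneMarkDensityLaw.Negative
open Summit.CriticalPhenomena.CardyFormulaZ2.Theses.CardyBoundaryCoulombGas (RectilinearCardy)
open scoped Topology

namespace BoxExhaustion

/-- Components of the mark vector. [folklore] -/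
theorem marks_apply (a b c y : ℝ) :
    (![a, b, c, y] : Fin 4 → ℝ) 0 = a ∧ (![a, b, c, y] : Fin 4 → ℝ) 1 = b ∧
      (![a, b, c, y] : Fin 4 → ℝ) 2 = c ∧ (![a, b, c, y] : Fin 4 → ℝ) 3 = y := by
  simp

/-- A strictly increasing quadruple gives a strictly monotone mark vector. [folklore] -/
theorem strictMono_marks {a b c y : ℝ} (hab : a < b) (hbc : b < c) (hcy : c < y) :
    StrictMono (![a, b, c, y] : Fin 4 → ℝ) := by
  refine Fin.strictMono_iff_lt_succ.2 fun i => ?_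
  fin_cases i <;> simp [hab, hbc, hcy]

/-- Every mark is bounded by `|a| + |b| + |c| + |y| + 1` in modulus (with room `1` for `ε' ≤ 1`).
[folklore] -/
theorem abs_marks_le (a b c y : ℝ) (i : Fin 4) :
    |(![a, b, c, y] : Fin 4 → ℝ) i| ≤ |a| + |b| + |c| + |y| := by
  have ha := abs_nonneg a; have hb := abs_nonneg b; have hc := abs_nonneg c; have hy := abs_nonneg y
  fin_cases i <;> simp <;> linarith

set_option maxHeartbeats 400000 in
/-- **The transfer `RectilinearCardy → C⁺`** (collinear half-plane Cardy for bond-`ℤ²`), by RSW box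
exhaustion; see the module docstring. [folklore] -/
theorem tendsto_halfPlane_crossing_of_rectilinearCardy (hRC : RectilinearCardy) {a b c y : ℝ}
    (hab : a < b) (hbc : b < c) (hcy : c < y) :
    Tendsto (fun n : ℕ ↦ μ.real (openCrossing halfPlane (arcA a b n) (rowIcc ⌊c * n⌋ ⌊y * n⌋))) atTop
      (𝓝 (cardyFunction (crossRatio ![a, b, c, y]))) := by
  /- Step 0: the Schwarz–Christoffel box and the boundary map `G`. -/
  obtain ⟨K, H, hK, hH, -, hbox⟩ := exists_scBox
  set G : ℝ → ℝ := ellipticF ((1 / 2 : ℝ) ^ 2) with hG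
  have hm0 : (0 : ℝ) ≤ (1 / 2 : ℝ) ^ 2 := by positivity
  have hm1 : (1 / 2 : ℝ) ^ 2 < 1 := by norm_num
  have hGm : StrictMonoOn G (Icc (-1) 1) := strictMonoOn_ellipticF hm0 hm1
  have hGc : ContinuousOn G (Icc (-1) 1) := continuousOn_ellipticF hm0 hm1
  have hG0 : G 0 = 0 := ellipticF_zero _
  have hGd : HasDerivAt G 1 0 := hasDerivAt_ellipticF_zero
  have h0I : (0 : ℝ) ∈ Icc (-1 : ℝ) 1 := ⟨by norm_num, by norm_num⟩
  have hhI : (1 / 2 : ℝ) ∈ Icc (-1 : ℝ) 1 := ⟨by norm_num, by norm_num⟩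
  have hG12 : 0 < G (1 / 2) := by
    have := hGm h0I hhI (by norm_num : (0 : ℝ) < 1 / 2); rwa [hG0] at this
  have hGneg : G (-(1 / 2)) = -G (1 / 2) := ellipticF_neg _ _
  -- preimages of small values
  have hpre : ∀ v : ℝ, |v| < G (1 / 2) → ∃ u ∈ Ioo (-(1 / 2) : ℝ) (1 / 2), G u = v := fun v hv =>
    exists_preimage_Ioo hGc
      (by rw [hGneg]; exact ⟨by linarith [neg_abs_le v, (abs_lt.1 hv).1], (abs_lt.1 hv).2⟩)
  choose! uOf huOf_mem huOf_eq using hpre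
  have hIoo_sub : Ioo (-(1 / 2) : ℝ) (1 / 2) ⊆ Ioo (-1 : ℝ) 1 := Ioo_subset_Ioo (by norm_num) (by norm_num)
  /- Step 1: constants. -/
  obtain ⟨C₀, α, -, hα, hesc⟩ := exists_real_boxToFar_le_rpow_of_le_half
  set M : ℕ := ⌈|a|⌉₊ + ⌈|b|⌉₊ + 1 with hM
  have hM1 : 1 ≤ M := by omega
  set Q : ℝ := |a| + |b| + |c| + |y| + 2 with hQ
  have haQ := abs_nonneg a; have hbQ := abs_nonneg b; have hcQ := abs_nonneg c; have hyQ := abs_nonneg y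
  have hQ2 : (2 : ℝ) ≤ Q := by rw [hQ]; linarith
  set D : ℝ := 4 * (M + Q + 1) with hD
  have hM0 : (0 : ℝ) ≤ M := Nat.cast_nonneg M
  have hD0 : 0 < D := by positivity
  set m₀ : ℝ := min (min K H) (G (1 / 2)) with hm₀
  have hm₀0 : 0 < m₀ := lt_min (lt_min hK hH) hG12
  have hm₀K : m₀ ≤ K := (min_le_left _ _).trans (min_le_left _ _)
  have hm₀H : m₀ ≤ H := (min_le_left _ _).trans (min_le_right _ _)
  have hm₀G : m₀ ≤ G (1 / 2) := min_le_right _ _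
  set κ : ℝ := m₀ / D with hκ
  have hκ0 : 0 < κ := div_pos hm₀0 hD0
  have hκD : κ * D = m₀ := div_mul_cancel₀ _ hD0.ne'
  -- the working bounds on `κ`
  have hκQ : κ * Q ≤ m₀ / 4 := by
    have : κ * (4 * Q) ≤ κ * D := mul_le_mul_of_nonneg_left (by nlinarith) hκ0.le
    linarith
  have hκM : κ * (M + 1) ≤ m₀ / 4 := by
    have : κ * (4 * (M + 1)) ≤ κ * D := mul_le_mul_of_nonneg_left (by nlinarith) hκ0.le
    linarith
  have hκ4 : κ ≤ m₀ / 4 := by nlinarith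
  /- Step 2: the marks, the limit value and continuity of `F`. -/
  obtain ⟨qv, hqv⟩ : ∃ qv : Fin 4 → ℝ, qv = ![a, b, c, y] := ⟨_, rfl⟩
  have hq0 : qv 0 = a := by simp [hqv]
  have hq1 : qv 1 = b := by simp [hqv]
  have hq2 : qv 2 = c := by simp [hqv]
  have hq3 : qv 3 = y := by simp [hqv]
  have hmono : StrictMono qv := by rw [hqv]; exact strictMono_marks hab hbc hcy
  rw [← hqv]
  set η := crossRatio qv with hη
  have hηmem : η ∈ Ioo (0 : ℝ) 1 := crossRatio_mem_Ioo (Or.inl hmono)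
  have hFcont : ∀ {x : ℝ}, x ∈ Ioo (0 : ℝ) 1 → ContinuousAt cardyFunction x := fun hx =>
    continuousOn_cardyFunction_Ioo.continuousAt (Ioo_mem_nhds hx.1 hx.2)
  have hqvQ : ∀ i, |qv i| + 1 ≤ Q := fun i => by
    have := abs_marks_le a b c y i; rw [hQ, hqv]; linarith
  /- Step 3: the sandwich criterion. -/
  refine tendsto_of_sandwich fun ε hε => ?_
  -- (3a) the slack `ε'`
  have hlimε : Tendsto (fun ε' : ℝ => cardyFunction (crossRatio ![a - ε', b, c - ε', y])) (𝓝 0)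
      (𝓝 (cardyFunction η)) := by
    have h1 : Tendsto (fun ε' : ℝ => (![a - ε', b, c - ε', y] : Fin 4 → ℝ)) (𝓝 0) (𝓝 qv) := by
      have := (continuous_marks_sub a b c y).tendsto 0
      simpa [hqv] using this
    exact (hFcont hηmem).tendsto.comp
      ((continuousAt_crossRatio (crossRatio_den_ne_zero hmono)).tendsto.comp h1)
  obtain ⟨ε', hε'0, hε'1, hε'cb, hε'F⟩ : ∃ ε' : ℝ, 0 < ε' ∧ ε' ≤ 1 ∧ ε' < c - b ∧
      cardyFunction (crossRatio ![a - ε', b, c - ε', y]) < cardyFunction η + ε / 2 := by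
    have hev1 : ∀ᶠ ε' in 𝓝 (0 : ℝ),
        cardyFunction (crossRatio ![a - ε', b, c - ε', y]) < cardyFunction η + ε / 2 :=
      hlimε.eventually (eventually_lt_nhds (by linarith))
    have hev2 : ∀ᶠ ε' in 𝓝 (0 : ℝ), ε' < min 1 (c - b) := eventually_lt_nhds (lt_min one_pos (by linarith))
    obtain ⟨ε', ⟨h1, h2⟩, h3⟩ :=
      (((hev1.and hev2).filter_mono (nhdsWithin_le_nhds (s := Ioi (0 : ℝ)))).and
        self_mem_nhdsWithin).exists
    exact ⟨ε', h3, h2.le.trans (min_le_left _ _), lt_of_lt_of_le h2 (min_le_right _ _), h1⟩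
  obtain ⟨qv', hqv'⟩ : ∃ qv' : Fin 4 → ℝ, qv' = ![a - ε', b, c - ε', y] := ⟨_, rfl⟩
  have hq0' : qv' 0 = a - ε' := by simp [hqv']
  have hq1' : qv' 1 = b := by simp [hqv']
  have hq2' : qv' 2 = c - ε' := by simp [hqv']
  have hq3' : qv' 3 = y := by simp [hqv']
  rw [← hqv'] at hε'F
  have hmono' : StrictMono qv' := by
    rw [hqv']; exact strictMono_marks (by linarith) (by linarith) (by linarith)
  -- (3b) mark bounds
  have hQa : |a| + 1 ≤ Q := by rw [hQ]; linarith
  have hQb : |b| + 1 ≤ Q := by rw [hQ]; linarith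
  have hQc : |c| + 1 ≤ Q := by rw [hQ]; linarith
  have hQy : |y| + 1 ≤ Q := by rw [hQ]; linarith
  have hQa' : |a - ε'| + 1 ≤ Q := by
    have h2 : |a - ε'| ≤ |a| + 1 := (abs_sub _ _).trans (by rw [abs_of_pos hε'0]; linarith)
    rw [hQ]; linarith
  have hQc' : |c - ε'| + 1 ≤ Q := by
    have h2 : |c - ε'| ≤ |c| + 1 := (abs_sub _ _).trans (by rw [abs_of_pos hε'0]; linarith)
    rw [hQ]; linarith
  have hqv'Q : ∀ i, |qv' i| + 1 ≤ Q := fun i => by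
    fin_cases i
    · simpa [hq0'] using hQa'
    · simpa [hq1'] using hQb
    · simpa [hq2'] using hQc'
    · simpa [hq3'] using hQy
  -- (3c) the preimage tuples at scale `t ∈ (0, κ]`
  have hval : ∀ (q : Fin 4 → ℝ), (∀ i, |q i| + 1 ≤ Q) → ∀ t, 0 < t → t ≤ κ →
      ∀ i, |t * q i| < G (1 / 2) := by
    intro q hq t ht htκ i
    rw [abs_mul, abs_of_pos ht]
    have h1 : t * |q i| ≤ κ * Q := by
      have := hq i
      calc t * |q i| ≤ κ * |q i| := mul_le_mul_of_nonneg_right htκ (abs_nonneg _)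
        _ ≤ κ * Q := mul_le_mul_of_nonneg_left (by linarith) hκ0.le
    linarith
  have hU : ∀ (q : Fin 4 → ℝ), StrictMono q → (∀ i, |q i| + 1 ≤ Q) → ∀ t, 0 < t → t ≤ κ →
      (∀ i, uOf (t * q i) ∈ Ioo (-(1 / 2) : ℝ) (1 / 2) ∧ G (uOf (t * q i)) = t * q i) ∧
        StrictMono (fun i => uOf (t * q i)) := by
    intro q hq hqQ t ht htκ
    have h1 : ∀ i, uOf (t * q i) ∈ Ioo (-(1 / 2) : ℝ) (1 / 2) ∧ G (uOf (t * q i)) = t * q i :=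
      fun i => ⟨huOf_mem _ (hval q hqQ t ht htκ i), huOf_eq _ (hval q hqQ t ht htκ i)⟩
    refine ⟨h1, fun i j hij => ?_⟩
    have hlt : G (uOf (t * q i)) < G (uOf (t * q j)) := by
      rw [(h1 i).2, (h1 j).2]; exact mul_lt_mul_of_pos_left (hq hij) ht
    exact (hGm.lt_iff_lt (Ioo_subset_Icc_self (hIoo_sub (h1 i).1))
      (Ioo_subset_Icc_self (hIoo_sub (h1 j).1))).1 hlt
  -- (3d) the limits `t → 0⁺` of the two moduli
  have hlimq : ∀ (q : Fin 4 → ℝ), StrictMono q → (∀ i, |q i| + 1 ≤ Q) →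
      Tendsto (fun t => cardyFunction (crossRatio fun i => uOf (t * q i))) (𝓝[>] 0)
        (𝓝 (cardyFunction (crossRatio q))) := by
    intro q hq hqQ
    refine (hFcont (crossRatio_mem_Ioo (Or.inl hq))).tendsto.comp
      (tendsto_crossRatio_of_preimages hGm hG0 hGd hq ?_)
    have hev : ∀ᶠ t in 𝓝[>] (0 : ℝ), t ≤ κ :=
      (eventually_le_nhds hκ0).filter_mono nhdsWithin_le_nhds
    filter_upwards [hev, self_mem_nhdsWithin] with t htκ ht i
    obtain ⟨h1, -⟩ := hU q hq hqQ t ht htκ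
    exact ⟨Ioo_subset_Icc_self (hIoo_sub (h1 i).1), (h1 i).2⟩
  -- (3e) choose the box scale `L`
  have hevL : ∀ᶠ L : ℕ in atTop,
      (cardyFunction η - ε < cardyFunction (crossRatio fun i => uOf (κ / L * qv i)) ∧
        cardyFunction (crossRatio fun i => uOf (κ / L * qv' i)) <
          cardyFunction (crossRatio qv') + ε / 2) ∧
      (C₀ * ((L : ℝ)⁻¹) ^ α < ε / 2 ∧ 1 ≤ L) := by
    refine (Filter.Eventually.and ?_ ?_).and
      (((tendsto_const_mul_inv_rpow C₀ hα).eventually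
        (eventually_lt_nhds (show (0 : ℝ) < ε / 2 by positivity))).and (eventually_ge_atTop 1))
    · exact ((hlimq qv hmono hqvQ).comp (tendsto_div_nat_nhdsWithin hκ0)).eventually
        (eventually_gt_nhds (by linarith))
    · exact ((hlimq qv' hmono' hqv'Q).comp (tendsto_div_nat_nhdsWithin hκ0)).eventually
        (eventually_lt_nhds (by linarith))
  obtain ⟨L, ⟨hL1, hL2⟩, hL3, hL⟩ := hevL.exists
  set t : ℝ := κ / L with ht
  have hLpos : (0 : ℝ) < L := by exact_mod_cast hL
  have ht0 : 0 < t := div_pos hκ0 hLpos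
  have htκ : t ≤ κ := div_le_self hκ0.le (by exact_mod_cast hL)
  -- (3f) the two rectangles at scale `t`
  obtain ⟨hUq, hUqmono⟩ := hU qv hmono hqvQ t ht0 htκ
  obtain ⟨hUq', hUq'mono⟩ := hU qv' hmono' hqv'Q t ht0 htκ
  obtain ⟨R, hRc, hR0, hR2, φ, hφ⟩ :=
    hbox (fun i => uOf (t * qv i)) hUqmono fun i => hIoo_sub (hUq i).1
  obtain ⟨R', hRc', hR0', hR2', φ', hφ'⟩ :=
    hbox (fun i => uOf (t * qv' i)) hUq'mono fun i => hIoo_sub (hUq' i).1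
  have hR0n : R.arc 0 = {z : ℂ | z.im = 0 ∧ z.re ∈ Icc (t * a) (t * b)} := by
    rw [hR0, (hUq 0).2, (hUq 1).2, hq0, hq1]
  have hR2n : R.arc 2 = {z : ℂ | z.im = 0 ∧ z.re ∈ Icc (t * c) (t * y)} := by
    rw [hR2, (hUq 2).2, (hUq 3).2, hq2, hq3]
  have hR0n' : R'.arc 0 = {z : ℂ | z.im = 0 ∧ z.re ∈ Icc (t * (a - ε')) (t * b)} := by
    rw [hR0', (hUq' 0).2, (hUq' 1).2, hq0', hq1']
  have hR2n' : R'.arc 2 = {z : ℂ | z.im = 0 ∧ z.re ∈ Icc (t * (c - ε')) (t * y)} := by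
    rw [hR2', (hUq' 2).2, (hUq' 3).2, hq2', hq3']
  -- (3g) geometric side conditions at scale `t`
  have hm4 : m₀ / 4 < min K H := by
    have := le_min hm₀K hm₀H; linarith
  have hmk : ∀ m : ℝ, |m| + 1 ≤ Q → t * (|m| + 1) < K := fun m hm => by
    have h1 : t * (|m| + 1) ≤ κ * Q := mul_le_mul htκ hm (by positivity) hκ0.le
    linarith
  have htH : 2 * t < H := by linarith
  have hgeo : t * (M * L + 1) < min K H := by
    have e : t * (M * L + 1) = κ * M + t := by
      calc t * (M * L + 1) = t * L * M + t := by ring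
        _ = κ * M + t := by rw [ht, div_mul_cancel₀ κ hLpos.ne']
    rw [e]
    have : κ * M + t ≤ κ * (M + 1) := by linarith
    linarith
  -- (3h) the sandwich data
  refine ⟨fun n => bondDomainCrossingProb R (t / n), fun n => bondDomainCrossingProb R' (t / n),
    cardyFunction (crossRatio fun i => uOf (t * qv i)),
    cardyFunction (crossRatio fun i => uOf (t * qv' i)),
    tendsto_bondDomainCrossingProb_box hRC hK hH R hRc hφ ht0,
    tendsto_bondDomainCrossingProb_box hRC hK hH R' hRc' hφ' ht0, hL1, by linarith, ?_⟩
  have hev := eventually_sandwich hK ht0 htH hab.le hcy.le hε'0 (hmk a hQa) (hmk b hQb) (hmk c hQc)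
    (hmk y hQy) (hmk (a - ε') hQa') (hmk (c - ε') hQc') R hRc hR0n hR2n R' hRc' hR0n' hR2n' hM hL hgeo
  filter_upwards [hev, eventually_ge_atTop 1] with n hn hn1
  refine ⟨hn.1, hn.2.trans ?_⟩
  have := escape_le hesc hM1 hn1 hL
  linarith

end BoxExhaustion

/-- **BoxExhaustion: `RectilinearCardy → stub_collinearCardy`** (line `Sketch`, crux
`HalfPlaneMarkDensityLaw`). Cardy's formula for bond-`ℤ²` at `p = 1/2` in rectilinear conformal
rectangles (the sibling crux stmt-CriticalPhenomena-5660) implies the collinear half-plane Cardy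
statement C⁺: for `a < b < c < y`,
`P_{1/2}[[⌊an⌋,⌊bn⌋]×{0} ↔ [⌊cn⌋,⌊yn⌋]×{0} in ℤ×ℕ] → F(η(a,b,c,y))` (RSW box exhaustion). [folklore] -/
theorem collinearCardy_of_rectilinearCardy :
    Summit.CriticalPhenomena.CardyFormulaZ2.Theses.CardyBoundaryCoulombGas.RectilinearCardy →
      (∀ a b c y : ℝ, a < b → b < c → c < y →
        Tendsto (fun n : ℕ ↦ μ.real (openCrossing halfPlane (arcA a b n) (rowIcc ⌊c * n⌋ ⌊y * n⌋)))
          atTop (𝓝 (Literature.Probability.RandomPlanarGeometry.cardyFunction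
            (Literature.Probability.RandomPlanarGeometry.crossRatio ![a, b, c, y])))) :=
  fun hRC _ _ _ _ hab hbc hcy =>
    BoxExhaustion.tendsto_halfPlane_crossing_of_rectilinearCardy hRC hab hbc hcy

end Summit.CriticalPhenomena.CardyFormulaZ2.Cruxes.HalfPlaneMarkDensityLaw.SketchLine

end
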